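import Literature.Probability.LatticeModels.LebowitzInequality
import Literature.Probability.LatticeModels.MeanFieldLowerBound
import HarnessLib

/-!
# The GHS inequality and the concavity of the finite-volume magnetisation in the field

Trunk G02 (T-STATMECH), topic `Probability/LatticeModels`; namespaces `Literature.StatMech` (the
inequality for the spin system `ν_{Λ;K}` of `GKSInequalities` with nonnegative couplings on
supports of at most two sites, and for the finite-volume Ising model with free or `+` boundary
condition) and `Literature.CritIsing` (the discharge `ghs_concaveOn_isingCorr_free_singleton_holds` of
the named fact of `MeanFieldLowerBound`, one of the inputs of the mean-field lower bound
`dct_magnetization_lower_bound` and hence of crit-ising.S08).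

## The statement

**GHS inequality** (Griffiths–Hurst–Sherman, J. Math. Phys. 11 (1970) 790; in the duplicated-
variable form of Lebowitz, *GHS and other inequalities*, Comm. Math. Phys. **35** (1974) 87–92,
eqs. (1.8), (2.3) and Theorem, eq. (2.5b)): for an Ising system with ferromagnetic pair
interactions and nonnegative fields, the third Ursell function is nonpositive,

  `u₃(i,j,k) = ⟨σᵢσⱼσ_k⟩ - ⟨σᵢσⱼ⟩⟨σ_k⟩ - ⟨σᵢσ_k⟩⟨σⱼ⟩ - ⟨σⱼσ_k⟩⟨σᵢ⟩ + 2⟨σᵢ⟩⟨σⱼ⟩⟨σ_k⟩ ≤ 0`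

(`ghs_gksSum`, `gksExpect_ghs`, `isingExpect_ghs`). Consequently (Friedli–Velenik 2017, §3.9,
"Uniqueness in Nonzero Magnetic Field", p. 140: "`∂²⟨σ_k⟩^∅_{Λ;β,h}/∂hᵢ∂hⱼ ≤ 0` … provided that
`h_ℓ ≥ 0` … it implies in particular that the magnetization density is concave as a function of
`h ≥ 0`"; Remark 3.41, p. 126) the one-point function `h ↦ ⟨σₓ⟩^{bc}_{Λ;β,h}` is concave on
`[0, ∞)` for `bc ∈ {free, +}` and `β ≥ 0` (`concaveOn_isingExpect_spinAt`).

## The proof given here (Lebowitz 1974, eq. (2.3), in the fourfold replica of Glimm–Jaffe 1987, §4.3)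

With the duplicated variables `T = σ + σ'`, `Q = σ - σ'` of `LebowitzInequality` (twice Lebowitz'
`t`, `q`), Lebowitz' identity (2.3) reads
`Z⁴ u₃(i,j,k) = ½ ∑_c QᵢQⱼ(ξ,χ) (T_k(ξ,χ) - T_k(ξ',χ')) w(ξ)w(χ)w(ξ')w(χ')`
(`sum_cfg4_qqDiffT_eq`), the sum running over the four replicas `c = (ξ, χ, ξ', χ')`. In the
rotated variables `A, B, C, D` of Glimm–Jaffe 1987, eq. (4.3.2) (`repA`–`repD`),
`QᵢQⱼ = ¼(Cᵢ - Dᵢ)(Cⱼ - Dⱼ)` and `T_k - T'_k = B_k`, so the sum is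
`¼ ∑ (CᵢCⱼB_k + DᵢDⱼB_k - CᵢDⱼB_k - DᵢCⱼB_k) w⁴`. The global exchange of the two pairs of
replicas `(ξ,χ,ξ',χ') ↦ (ξ',χ',ξ,χ)` (`repSwapPairs`) preserves the replicated weight and maps
`A, C ↦ A, C`, `B, D ↦ -B, -D`, so the first two sums vanish; the last two are nonnegative by the
positivity of the replicated Gibbs weight on monomials in `A, B, C, D`
(`sum_repClass_mul_gksWeight4_nonneg`, Glimm–Jaffe 1987, Thm. 4.3.1 — the tree's proof of
Lebowitz' theorem, valid for nonnegative couplings on supports of at most two sites). Hence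
`u₃ ≤ 0`. This is Lebowitz' route "(2.5) together with (2.3) imply the GHS inequality" with
(2.5b) replaced by the class positivity from which the tree derives it.

Concavity: `d/dh ⟨σₓ⟩ = β ∑_y ⟨σₓ;σ_y⟩` (`hasDerivAt_isingExpect_field` of `MeanFieldLowerBound`)
and `d/dh ⟨σₓ;σ_y⟩ = β ∑_z u₃(x,y,z) ≤ 0`, so the derivative is antitone on `(0, ∞)` and
`AntitoneOn.concaveOn_of_deriv` applies on `[0, ∞)`.

## References

* R. B. Griffiths, C. A. Hurst, S. Sherman, *Concavity of magnetization of an Ising ferromagnet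
  in a positive external field*, J. Math. Phys. 11 (1970) 790–795 [GriffithsHurstSherman1970]
  (not held; cited through Lebowitz 1974 and Friedli–Velenik 2017).
* J. L. Lebowitz, *GHS and other inequalities*, Comm. Math. Phys. 35 (1974) 87–92, eqs. (1.8),
  (2.3), Theorem (2.5b) [Lebowitz1974].
* J. Glimm, A. Jaffe, *Quantum Physics*, 2nd ed. (1987), §4.3, Thm. 4.3.1, Cor. 4.3.2
  [GlimmJaffe1987].
* S. Friedli, Y. Velenik, *Statistical Mechanics of Lattice Systems* (CUP 2017), Remark 3.41
  (p. 126) and §3.9, p. 140 [FriedliVelenik2017].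
-/

noncomputable section

open Finset MeasureTheory Set
open scoped symmDiff

namespace Literature.Probability.LatticeModels

/-! ### The global exchange of the two pairs of replicas -/

section Replica

variable {Λ : Type*}

/-- The exchange of the two pairs of replicas, `(ξ, χ, ξ', χ') ↦ (ξ', χ', ξ, χ)`; unlike the
site-wise symmetries `repSwap₁`, `repSwap₂` of `LebowitzInequality` it preserves the replicated
Gibbs weight. [folklore] -/
def repSwapPairs (c : Cfg4 Λ) : Cfg4 Λ := (c.2.2.1, c.2.2.2, c.1, c.2.1)

/-- `repSwapPairs` is an involution. [folklore] -/
theorem repSwapPairs_involutive : Function.Involutive (repSwapPairs (Λ := Λ)) := fun _ => rfl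

/-- `A` is invariant under the exchange of the pairs of replicas. [folklore] -/
theorem repA_repSwapPairs (x : Λ) (c : Cfg4 Λ) : repA x (repSwapPairs c) = repA x c := by
  simp only [repA, repSwapPairs]; ring

/-- `B` changes sign under the exchange of the pairs of replicas. [folklore] -/
theorem repB_repSwapPairs (x : Λ) (c : Cfg4 Λ) : repB x (repSwapPairs c) = -repB x c := by
  simp only [repB, repSwapPairs]; ring

/-- `C` is invariant under the exchange of the pairs of replicas. [folklore] -/
theorem repC_repSwapPairs (x : Λ) (c : Cfg4 Λ) : repC x (repSwapPairs c) = repC x c := by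
  simp only [repC, repSwapPairs]; ring

/-- `D` changes sign under the exchange of the pairs of replicas. [folklore] -/
theorem repD_repSwapPairs (x : Λ) (c : Cfg4 Λ) : repD x (repSwapPairs c) = -repD x c := by
  simp only [repD, repSwapPairs]; ring

end Replica

/-! ### The GHS inequality for `ν_{Λ;K}` with pair and single-site couplings -/

section GHS

variable {Λ : Type*} [Fintype Λ] [DecidableEq Λ] {ι : Type*}
variable (s : Finset ι) (K : ι → ℝ) (C : ι → Finset Λ)

omit [Fintype Λ] [DecidableEq Λ] in
/-- The replicated Gibbs weight is invariant under the exchange of the pairs of replicas. [folklore] -/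
theorem gksWeight4_repSwapPairs (c : Cfg4 Λ) :
    gksWeight4 s K C (repSwapPairs c) = gksWeight4 s K C c := by
  simp only [gksWeight4, repSwapPairs]; ring

/-- **The sign of Lebowitz' combination** (Lebowitz 1974, eq. (2.3) with Theorem (2.5b); here from
Glimm–Jaffe 1987, Thm. 4.3.1): for nonnegative couplings on supports of at most two sites and all
sites `i, j, k`, `∑_c QᵢQⱼ(ξ,χ) (T_k(ξ,χ) - T_k(ξ',χ')) w⁴ ≤ 0`. In the rotated variables the
summand is `¼(CᵢCⱼ + DᵢDⱼ - CᵢDⱼ - DᵢCⱼ)B_k w⁴`; the first two sums vanish by the exchange of the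
pairs of replicas (`B ↦ -B`, `C ↦ C`, `D ↦ -D`), the last two are nonnegative monomial sums. [cite: Lebowitz1974, eq. (2.3) and Theorem, eq. (2.5b)] [cite: GlimmJaffe1987, Thm. 4.3.1] -/
theorem sum_cfg4_qqDiffT_mul_gksWeight4_nonpos (hK : ∀ i ∈ s, 0 ≤ K i)
    (hC : ∀ i ∈ s, (C i).card ≤ 2) (i j k : Λ) :
    ∑ c : Cfg4 Λ, qVar2 i c.1 c.2.1 * qVar2 j c.1 c.2.1 *
        (tVar2 k c.1 c.2.1 - tVar2 k c.2.2.1 c.2.2.2) * gksWeight4 s K C c ≤ 0 := by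
  have hpos := sum_repClass_mul_gksWeight4_nonneg s K C hK hC
  have key : ∀ c : Cfg4 Λ, qVar2 i c.1 c.2.1 * qVar2 j c.1 c.2.1 *
        (tVar2 k c.1 c.2.1 - tVar2 k c.2.2.1 c.2.2.2) * gksWeight4 s K C c =
      4⁻¹ * (repC i c * repC j c * repB k c * gksWeight4 s K C c) +
      4⁻¹ * (repD i c * repD j c * repB k c * gksWeight4 s K C c) -
      4⁻¹ * (repC i c * repD j c * repB k c * gksWeight4 s K C c) -
      4⁻¹ * (repD i c * repC j c * repB k c * gksWeight4 s K C c) := by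
    intro c
    have hT : tVar2 k c.1 c.2.1 - tVar2 k c.2.2.1 c.2.2.2 = repB k c := by
      simp only [tVar2, repB]; ring
    rw [qVar2_eq, qVar2_eq, hT]; ring
  have h1 : ∑ c : Cfg4 Λ, repC i c * repC j c * repB k c * gksWeight4 s K C c = 0 :=
    sum_cfg4_eq_zero_of_odd repSwapPairs_involutive _ fun c => by
      rw [repC_repSwapPairs, repC_repSwapPairs, repB_repSwapPairs, gksWeight4_repSwapPairs]; ring
  have h2 : ∑ c : Cfg4 Λ, repD i c * repD j c * repB k c * gksWeight4 s K C c = 0 :=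
    sum_cfg4_eq_zero_of_odd repSwapPairs_involutive _ fun c => by
      rw [repD_repSwapPairs, repD_repSwapPairs, repB_repSwapPairs, gksWeight4_repSwapPairs]; ring
  have h3 : 0 ≤ ∑ c : Cfg4 Λ, repC i c * repD j c * repB k c * gksWeight4 s K C c :=
    hpos (fun c => repC i c * repD j c * repB k c)
      (mul_mem_repClass (mul_mem_repClass (repC_mem_repClass i) (repD_mem_repClass j))
        (repB_mem_repClass k))
  have h4 : 0 ≤ ∑ c : Cfg4 Λ, repD i c * repC j c * repB k c * gksWeight4 s K C c :=
    hpos (fun c => repD i c * repC j c * repB k c)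
      (mul_mem_repClass (mul_mem_repClass (repD_mem_repClass i) (repC_mem_repClass j))
        (repB_mem_repClass k))
  simp_rw [key]
  rw [Finset.sum_sub_distrib, Finset.sum_sub_distrib, Finset.sum_add_distrib, ← Finset.mul_sum,
    ← Finset.mul_sum, ← Finset.mul_sum, ← Finset.mul_sum, h1, h2]
  linarith

/-- `∑∑ T_k ww = 2 (Z⟨σ_k⟩) Z`. [folklore] -/
theorem gksSum2_tVar2 (k : Λ) :
    gksSum2 s K C (fun ξ χ => tVar2 k ξ χ) =
      2 * (gksSum s K C (fun σ => spinAt k σ) * gksSum s K C (fun _ => 1)) := by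
  have key : ∀ ξ χ : SpinConfig Λ, tVar2 k ξ χ * (gksWeight s K C ξ * gksWeight s K C χ) =
      (spinAt k ξ * gksWeight s K C ξ) * (1 * gksWeight s K C χ) +
      (1 * gksWeight s K C ξ) * (spinAt k χ * gksWeight s K C χ) := by
    intro ξ χ; simp only [tVar2]; ring
  simp only [gksSum2, key, Finset.sum_add_distrib, ← Finset.sum_mul_sum]
  simp only [gksSum]
  ring

/-- `∑∑ QᵢQⱼ ww = 2 (Z⟨σᵢσⱼ⟩) Z - 2 (Z⟨σᵢ⟩)(Z⟨σⱼ⟩)` (the lambda form of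
`gksSum2_qVar2_mul`). [folklore] -/
theorem gksSum2_qVar2_mul' (i j : Λ) :
    gksSum2 s K C (fun ξ χ => qVar2 i ξ χ * qVar2 j ξ χ) =
      2 * (gksSum s K C (fun σ => spinAt i σ * spinAt j σ) * gksSum s K C (fun _ => 1)) -
        2 * (gksSum s K C (fun σ => spinAt i σ) * gksSum s K C (fun σ => spinAt j σ)) := by
  have key : ∀ ξ χ : SpinConfig Λ, qVar2 i ξ χ * qVar2 j ξ χ * (gksWeight s K C ξ * gksWeight s K C χ) =
      (spinAt i ξ * spinAt j ξ * gksWeight s K C ξ) * (1 * gksWeight s K C χ) +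
      (1 * gksWeight s K C ξ) * (spinAt i χ * spinAt j χ * gksWeight s K C χ) -
      ((spinAt i ξ * gksWeight s K C ξ) * (spinAt j χ * gksWeight s K C χ) +
      (spinAt j ξ * gksWeight s K C ξ) * (spinAt i χ * gksWeight s K C χ)) := by
    intro ξ χ; simp only [qVar2]; ring
  simp only [gksSum2, key, Finset.sum_add_distrib, Finset.sum_sub_distrib, ← Finset.sum_mul_sum]
  simp only [gksSum]
  ring

/-- `∑∑ QᵢQⱼT_k ww = 2 Z (Z⟨σᵢσⱼσ_k⟩) + 2 (Z⟨σᵢσⱼ⟩)(Z⟨σ_k⟩) - 2 (Z⟨σᵢσ_k⟩)(Z⟨σⱼ⟩) - 2 (Z⟨σⱼσ_k⟩)(Z⟨σᵢ⟩)`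
(the expansion behind Lebowitz 1974, eq. (2.3)). [cite: Lebowitz1974, eq. (2.3)] -/
theorem gksSum2_qqt (i j k : Λ) :
    gksSum2 s K C (fun ξ χ => qVar2 i ξ χ * qVar2 j ξ χ * tVar2 k ξ χ) =
      2 * (gksSum s K C (fun _ => 1) *
          gksSum s K C (fun σ => spinAt i σ * spinAt j σ * spinAt k σ)) +
        2 * (gksSum s K C (fun σ => spinAt i σ * spinAt j σ) * gksSum s K C (fun σ => spinAt k σ)) -
        2 * (gksSum s K C (fun σ => spinAt i σ * spinAt k σ) * gksSum s K C (fun σ => spinAt j σ)) -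
        2 * (gksSum s K C (fun σ => spinAt j σ * spinAt k σ) * gksSum s K C (fun σ => spinAt i σ)) := by
  have key : ∀ ξ χ : SpinConfig Λ,
      qVar2 i ξ χ * qVar2 j ξ χ * tVar2 k ξ χ * (gksWeight s K C ξ * gksWeight s K C χ) =
      (spinAt i ξ * spinAt j ξ * spinAt k ξ * gksWeight s K C ξ) * (1 * gksWeight s K C χ) +
      (1 * gksWeight s K C ξ) * (spinAt i χ * spinAt j χ * spinAt k χ * gksWeight s K C χ) +
      ((spinAt i ξ * spinAt j ξ * gksWeight s K C ξ) * (spinAt k χ * gksWeight s K C χ) +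
       (spinAt k ξ * gksWeight s K C ξ) * (spinAt i χ * spinAt j χ * gksWeight s K C χ)) -
      ((spinAt i ξ * spinAt k ξ * gksWeight s K C ξ) * (spinAt j χ * gksWeight s K C χ) +
       (spinAt j ξ * gksWeight s K C ξ) * (spinAt i χ * spinAt k χ * gksWeight s K C χ)) -
      ((spinAt j ξ * spinAt k ξ * gksWeight s K C ξ) * (spinAt i χ * gksWeight s K C χ) +
       (spinAt i ξ * gksWeight s K C ξ) * (spinAt j χ * spinAt k χ * gksWeight s K C χ)) := by
    intro ξ χ; simp only [qVar2, tVar2]; ring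
  simp only [gksSum2, key, Finset.sum_add_distrib, Finset.sum_sub_distrib, ← Finset.sum_mul_sum]
  simp only [gksSum]
  ring

/-- **Lebowitz' identity (2.3) for the third Ursell function** (Lebowitz 1974, eq. (2.3):
`u₃(i,j,k) = 4[⟨qᵢqⱼt_k⟩ - ⟨qᵢqⱼ⟩⟨t_k⟩]` in the duplicated system; here unnormalised, with
`Q = 2q`, `T = 2t`, and the product of duplicated expectations written as one sum over four
replicas): `∑_c QᵢQⱼ(ξ,χ)(T_k(ξ,χ) - T_k(ξ',χ')) w⁴ = 2Z · (Z² (Z⟨σᵢσⱼσ_k⟩) - Z((Z⟨σᵢσⱼ⟩)(Z⟨σ_k⟩)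
+ (Z⟨σᵢσ_k⟩)(Z⟨σⱼ⟩) + (Z⟨σⱼσ_k⟩)(Z⟨σᵢ⟩)) + 2(Z⟨σᵢ⟩)(Z⟨σⱼ⟩)(Z⟨σ_k⟩))`. [cite: Lebowitz1974, eq. (2.3)] -/
theorem sum_cfg4_qqDiffT_eq (i j k : Λ) :
    ∑ c : Cfg4 Λ, qVar2 i c.1 c.2.1 * qVar2 j c.1 c.2.1 *
        (tVar2 k c.1 c.2.1 - tVar2 k c.2.2.1 c.2.2.2) * gksWeight4 s K C c =
      2 * gksSum s K C (fun _ => 1) *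
        (gksSum s K C (fun _ => 1) ^ 2 *
            gksSum s K C (fun σ => spinAt i σ * spinAt j σ * spinAt k σ) -
          gksSum s K C (fun _ => 1) *
            (gksSum s K C (fun σ => spinAt i σ * spinAt j σ) * gksSum s K C (fun σ => spinAt k σ) +
              gksSum s K C (fun σ => spinAt i σ * spinAt k σ) * gksSum s K C (fun σ => spinAt j σ) +
              gksSum s K C (fun σ => spinAt j σ * spinAt k σ) * gksSum s K C (fun σ => spinAt i σ)) +
          2 * (gksSum s K C (fun σ => spinAt i σ) * gksSum s K C (fun σ => spinAt j σ) *
            gksSum s K C (fun σ => spinAt k σ))) := by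
  have hsplit : ∀ c : Cfg4 Λ, qVar2 i c.1 c.2.1 * qVar2 j c.1 c.2.1 *
        (tVar2 k c.1 c.2.1 - tVar2 k c.2.2.1 c.2.2.2) * gksWeight4 s K C c =
      qVar2 i c.1 c.2.1 * qVar2 j c.1 c.2.1 * tVar2 k c.1 c.2.1 * 1 * gksWeight4 s K C c -
        qVar2 i c.1 c.2.1 * qVar2 j c.1 c.2.1 * tVar2 k c.2.2.1 c.2.2.2 * gksWeight4 s K C c := by
    intro c; ring
  have hA : ∑ c : Cfg4 Λ, qVar2 i c.1 c.2.1 * qVar2 j c.1 c.2.1 * tVar2 k c.1 c.2.1 * 1 *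
        gksWeight4 s K C c =
      gksSum2 s K C (fun ξ χ => qVar2 i ξ χ * qVar2 j ξ χ * tVar2 k ξ χ) *
        gksSum2 s K C (fun _ _ => 1) :=
    sum_cfg4_mul_mul_gksWeight4 s K C (fun ξ χ => qVar2 i ξ χ * qVar2 j ξ χ * tVar2 k ξ χ)
      (fun _ _ => 1)
  have hB : ∑ c : Cfg4 Λ, qVar2 i c.1 c.2.1 * qVar2 j c.1 c.2.1 * tVar2 k c.2.2.1 c.2.2.2 *
        gksWeight4 s K C c =
      gksSum2 s K C (fun ξ χ => qVar2 i ξ χ * qVar2 j ξ χ) * gksSum2 s K C (fun ξ χ => tVar2 k ξ χ) :=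
    sum_cfg4_mul_mul_gksWeight4 s K C (fun ξ χ => qVar2 i ξ χ * qVar2 j ξ χ) (fun ξ χ => tVar2 k ξ χ)
  simp_rw [hsplit]
  rw [Finset.sum_sub_distrib, hA, hB, gksSum2_qqt, gksSum2_one, gksSum2_qVar2_mul', gksSum2_tVar2]
  ring

/-- **The GHS inequality, unnormalised** (Griffiths–Hurst–Sherman 1970; Lebowitz 1974, eq. (1.8)
from (2.3) and Theorem (2.5b)): for `Kᵢ ≥ 0` on supports of at most two sites (ferromagnetic pair
interactions and nonnegative fields) and all sites `i, j, k`,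
`Z²(Z⟨σᵢσⱼσ_k⟩) - Z((Z⟨σᵢσⱼ⟩)(Z⟨σ_k⟩) + (Z⟨σᵢσ_k⟩)(Z⟨σⱼ⟩) + (Z⟨σⱼσ_k⟩)(Z⟨σᵢ⟩)) + 2(Z⟨σᵢ⟩)(Z⟨σⱼ⟩)(Z⟨σ_k⟩) ≤ 0`,
i.e. `Z³ u₃(i,j,k) ≤ 0`. [cite: Lebowitz1974, eq. (1.8), eq. (2.3) and Theorem, eq. (2.5b)] [cite: FriedliVelenik2017, §3.9, p. 140 (GHS inequality)] -/
theorem ghs_gksSum (hK : ∀ i ∈ s, 0 ≤ K i) (hC : ∀ i ∈ s, (C i).card ≤ 2) (i j k : Λ) :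
    gksSum s K C (fun _ => 1) ^ 2 * gksSum s K C (fun σ => spinAt i σ * spinAt j σ * spinAt k σ) -
        gksSum s K C (fun _ => 1) *
          (gksSum s K C (fun σ => spinAt i σ * spinAt j σ) * gksSum s K C (fun σ => spinAt k σ) +
            gksSum s K C (fun σ => spinAt i σ * spinAt k σ) * gksSum s K C (fun σ => spinAt j σ) +
            gksSum s K C (fun σ => spinAt j σ * spinAt k σ) * gksSum s K C (fun σ => spinAt i σ)) +
        2 * (gksSum s K C (fun σ => spinAt i σ) * gksSum s K C (fun σ => spinAt j σ) *
          gksSum s K C (fun σ => spinAt k σ)) ≤ 0 := by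
  have hX := sum_cfg4_qqDiffT_mul_gksWeight4_nonpos s K C hK hC i j k
  rw [sum_cfg4_qqDiffT_eq] at hX
  have hZ : 0 < gksSum s K C (fun _ => 1) := gksSum_one_pos s K C
  by_contra hcon
  replace hcon := not_le.1 hcon
  have : 0 < 2 * gksSum s K C (fun _ => 1) *
      (gksSum s K C (fun _ => 1) ^ 2 * gksSum s K C (fun σ => spinAt i σ * spinAt j σ * spinAt k σ) -
        gksSum s K C (fun _ => 1) *
          (gksSum s K C (fun σ => spinAt i σ * spinAt j σ) * gksSum s K C (fun σ => spinAt k σ) +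
            gksSum s K C (fun σ => spinAt i σ * spinAt k σ) * gksSum s K C (fun σ => spinAt j σ) +
            gksSum s K C (fun σ => spinAt j σ * spinAt k σ) * gksSum s K C (fun σ => spinAt i σ)) +
        2 * (gksSum s K C (fun σ => spinAt i σ) * gksSum s K C (fun σ => spinAt j σ) *
          gksSum s K C (fun σ => spinAt k σ))) :=
    mul_pos (mul_pos two_pos hZ) hcon
  linarith

/-- **The GHS inequality** `u₃(i,j,k) ≤ 0` for the expectation `⟨·⟩_{Λ;K}` of `ν_{Λ;K}` with
`Kᵢ ≥ 0` on supports of at most two sites (Griffiths–Hurst–Sherman 1970; Lebowitz 1974,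
eq. (1.8)): `⟨σᵢσⱼσ_k⟩ - ⟨σᵢσⱼ⟩⟨σ_k⟩ - ⟨σᵢσ_k⟩⟨σⱼ⟩ - ⟨σⱼσ_k⟩⟨σᵢ⟩ + 2⟨σᵢ⟩⟨σⱼ⟩⟨σ_k⟩ ≤ 0`. [cite: Lebowitz1974, eq. (1.8), eq. (2.3) and Theorem, eq. (2.5b)] [cite: FriedliVelenik2017, §3.9, p. 140 (GHS inequality)] -/
theorem gksExpect_ghs (hK : ∀ i ∈ s, 0 ≤ K i) (hC : ∀ i ∈ s, (C i).card ≤ 2) (i j k : Λ) :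
    gksExpect s K C (fun σ => spinAt i σ * spinAt j σ * spinAt k σ) -
        gksExpect s K C (fun σ => spinAt i σ * spinAt j σ) * gksExpect s K C (fun σ => spinAt k σ) -
        gksExpect s K C (fun σ => spinAt i σ * spinAt k σ) * gksExpect s K C (fun σ => spinAt j σ) -
        gksExpect s K C (fun σ => spinAt j σ * spinAt k σ) * gksExpect s K C (fun σ => spinAt i σ) +
        2 * (gksExpect s K C (fun σ => spinAt i σ) * gksExpect s K C (fun σ => spinAt j σ) *
          gksExpect s K C (fun σ => spinAt k σ)) ≤ 0 := by
  have hB := ghs_gksSum s K C hK hC i j k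
  have hZ : 0 < gksSum s K C (fun _ => 1) := gksSum_one_pos s K C
  set Z := gksSum s K C (fun _ => 1) with hZdef
  simp only [gksExpect, ← hZdef]
  have hrew : gksSum s K C (fun σ => spinAt i σ * spinAt j σ * spinAt k σ) / Z -
        gksSum s K C (fun σ => spinAt i σ * spinAt j σ) / Z * (gksSum s K C (fun σ => spinAt k σ) / Z) -
        gksSum s K C (fun σ => spinAt i σ * spinAt k σ) / Z * (gksSum s K C (fun σ => spinAt j σ) / Z) -
        gksSum s K C (fun σ => spinAt j σ * spinAt k σ) / Z * (gksSum s K C (fun σ => spinAt i σ) / Z) +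
        2 * (gksSum s K C (fun σ => spinAt i σ) / Z * (gksSum s K C (fun σ => spinAt j σ) / Z) *
          (gksSum s K C (fun σ => spinAt k σ) / Z)) =
      (Z ^ 2 * gksSum s K C (fun σ => spinAt i σ * spinAt j σ * spinAt k σ) -
        Z * (gksSum s K C (fun σ => spinAt i σ * spinAt j σ) * gksSum s K C (fun σ => spinAt k σ) +
            gksSum s K C (fun σ => spinAt i σ * spinAt k σ) * gksSum s K C (fun σ => spinAt j σ) +
            gksSum s K C (fun σ => spinAt j σ * spinAt k σ) * gksSum s K C (fun σ => spinAt i σ)) +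
        2 * (gksSum s K C (fun σ => spinAt i σ) * gksSum s K C (fun σ => spinAt j σ) *
          gksSum s K C (fun σ => spinAt k σ))) / Z ^ 3 := by
    field_simp
    ring
  rw [hrew]
  exact div_nonpos_iff.2 (Or.inr ⟨hB, by positivity⟩)

end GHS

/-! ### The GHS inequality for the finite-volume Ising model and the concavity in the field -/

section Ising

variable {V : Type*} [DecidableEq V] (G : SimpleGraph V) [G.LocallyFinite]

/-- The finite-sum formula for `⟨f⟩^{bc}_{Λ;β,h}` in terms of the spin system `ν_{Λ;K}` of
`GKSInequalities` (`isingWeight_eq_gksWeight`): `⟨f⟩ = (∑_τ f(τ·bc) w(τ)) / ∑_τ w(τ)`. [cite: FriedliVelenik2017, §3.8.1, p. 141] -/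
theorem isingExpect_eq_gksSum_div (Λ : Finset V) (β h : ℝ) (bc : BoundaryCondition V)
    {f : SpinConfig V → ℝ} (hf : Measurable f) :
    isingExpect G Λ β h bc f =
      gksSum (isingIdx G Λ) (gksCoupling G Λ β h bc) (isingSupp Λ) (fun τ => f (glue Λ τ bc)) /
        gksSum (isingIdx G Λ) (gksCoupling G Λ β h bc) (isingSupp Λ) (fun _ => 1) := by
  rw [isingExpect_eq_sum_div G Λ h bc β hf, gksSum, gksSum, isingPartitionFunction]
  congr 1
  · exact Finset.sum_congr rfl fun τ _ => by rw [isingWeight_eq_gksWeight, mul_comm]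
  · exact Finset.sum_congr rfl fun τ _ => by rw [isingWeight_eq_gksWeight, one_mul]

/-- **The GHS inequality for the finite-volume Ising model** with free or `+` boundary condition,
`β ≥ 0`, `h ≥ 0` (Griffiths–Hurst–Sherman 1970; Lebowitz 1974, eq. (1.8); Friedli–Velenik 2017,
§3.9, p. 140): for `x, y, z ∈ Λ`,
`⟨σₓσ_yσ_z⟩ - ⟨σₓσ_y⟩⟨σ_z⟩ - ⟨σₓσ_z⟩⟨σ_y⟩ - ⟨σ_yσ_z⟩⟨σₓ⟩ + 2⟨σₓ⟩⟨σ_y⟩⟨σ_z⟩ ≤ 0` (the `+`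
boundary condition only adds nonnegative one-body couplings). [cite: Lebowitz1974, eq. (1.8), eq. (2.3) and Theorem, eq. (2.5b)] [cite: FriedliVelenik2017, §3.9, p. 140 (GHS inequality)] -/
theorem isingExpect_ghs {Λ : Finset V} {β h : ℝ} (hβ : 0 ≤ β) (hh : 0 ≤ h)
    {bc : BoundaryCondition V} (hbc : bc = .free ∨ bc = .plus) {x y z : V} (hx : x ∈ Λ)
    (hy : y ∈ Λ) (hz : z ∈ Λ) :
    isingExpect G Λ β h bc (fun σ => spinAt x σ * spinAt y σ * spinAt z σ) -
        isingExpect G Λ β h bc (fun σ => spinAt x σ * spinAt y σ) * isingExpect G Λ β h bc (spinAt z) -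
        isingExpect G Λ β h bc (fun σ => spinAt x σ * spinAt z σ) * isingExpect G Λ β h bc (spinAt y) -
        isingExpect G Λ β h bc (fun σ => spinAt y σ * spinAt z σ) * isingExpect G Λ β h bc (spinAt x) +
        2 * (isingExpect G Λ β h bc (spinAt x) * isingExpect G Λ β h bc (spinAt y) *
          isingExpect G Λ β h bc (spinAt z)) ≤ 0 := by
  have mx := measurable_spinAt (V := V) x
  have my := measurable_spinAt (V := V) y
  have mz := measurable_spinAt (V := V) z
  have mxyz : Measurable fun σ : SpinConfig V => spinAt x σ * spinAt y σ * spinAt z σ :=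
    (mx.mul my).mul mz
  have mxy : Measurable fun σ : SpinConfig V => spinAt x σ * spinAt y σ := mx.mul my
  have mxz : Measurable fun σ : SpinConfig V => spinAt x σ * spinAt z σ := mx.mul mz
  have myz : Measurable fun σ : SpinConfig V => spinAt y σ * spinAt z σ := my.mul mz
  rw [isingExpect_eq_gksSum_div G Λ β h bc mxyz,
    isingExpect_eq_gksSum_div G Λ β h bc mxy, isingExpect_eq_gksSum_div G Λ β h bc mxz,
    isingExpect_eq_gksSum_div G Λ β h bc myz, isingExpect_eq_gksSum_div G Λ β h bc mx,
    isingExpect_eq_gksSum_div G Λ β h bc my, isingExpect_eq_gksSum_div G Λ β h bc mz]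
  simp only [spinAt_glue_of_mem _ _ hx, spinAt_glue_of_mem _ _ hy, spinAt_glue_of_mem _ _ hz]
  have h := gksExpect_ghs (isingIdx G Λ) (gksCoupling G Λ β h bc) (isingSupp Λ)
    (gksCoupling_nonneg G hβ hh hbc) (fun i _ => card_isingSupp_le_two Λ i) ⟨x, hx⟩ ⟨y, hy⟩ ⟨z, hz⟩
  simpa only [gksExpect] using h

/-- **The field derivative of the one-point function**:
`d/dh ⟨σₓ⟩ = β ∑_{y ∈ Λ} (⟨σₓσ_y⟩ - ⟨σₓ⟩⟨σ_y⟩)` (tree parametrisation, field `βh`). [cite: FriedliVelenik2017, Lemma 3.31 (1), proof (h-derivative of ⟨σ₀⟩), p. 119] -/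
theorem hasDerivAt_isingExpect_spinAt_field (Λ : Finset V) (β h : ℝ) (bc : BoundaryCondition V)
    (x : V) :
    HasDerivAt (fun h => isingExpect G Λ β h bc (spinAt x))
      (β * ∑ y ∈ Λ, (isingExpect G Λ β h bc (fun σ => spinAt x σ * spinAt y σ) -
        isingExpect G Λ β h bc (spinAt x) * isingExpect G Λ β h bc (spinAt y))) h := by
  have mx := measurable_spinAt (V := V) x
  have hd := Literature.Probability.LatticeModels.hasDerivAt_isingExpect_field G Λ β h bc mx
  refine hd.congr_deriv ?_
  have h1 : isingExpect G Λ β h bc (fun σ => spinAt x σ * ∑ y ∈ Λ, spinAt y σ) =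
      ∑ y ∈ Λ, isingExpect G Λ β h bc (fun σ => spinAt x σ * spinAt y σ) := by
    have : (fun σ : SpinConfig V => spinAt x σ * ∑ y ∈ Λ, spinAt y σ) =
        fun σ => ∑ y ∈ Λ, spinAt x σ * spinAt y σ := by
      funext σ; rw [Finset.mul_sum]
    rw [this, isingExpect_finset_sum' G Λ h bc β Λ (fun y σ => spinAt x σ * spinAt y σ)
      (fun y => mx.mul (measurable_spinAt y))]
  have h2 : isingExpect G Λ β h bc (fun σ => ∑ y ∈ Λ, spinAt y σ) =
      ∑ y ∈ Λ, isingExpect G Λ β h bc (spinAt y) :=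
    isingExpect_finset_sum' G Λ h bc β Λ (fun y σ => spinAt y σ) (fun y => measurable_spinAt y)
  rw [h1, h2, Finset.mul_sum, ← Finset.sum_sub_distrib]

/-- **The field derivative of a truncated two-point function**:
`d/dh (⟨σₓσ_y⟩ - ⟨σₓ⟩⟨σ_y⟩) = β ∑_{z ∈ Λ} u₃(x,y,z)`. [folklore] -/
theorem hasDerivAt_isingTrunc_field (Λ : Finset V) (β h : ℝ) (bc : BoundaryCondition V)
    (x y : V) :
    HasDerivAt (fun h => isingExpect G Λ β h bc (fun σ => spinAt x σ * spinAt y σ) -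
        isingExpect G Λ β h bc (spinAt x) * isingExpect G Λ β h bc (spinAt y))
      (β * ∑ z ∈ Λ,
        (isingExpect G Λ β h bc (fun σ => spinAt x σ * spinAt y σ * spinAt z σ) -
          isingExpect G Λ β h bc (fun σ => spinAt x σ * spinAt y σ) * isingExpect G Λ β h bc (spinAt z) -
          isingExpect G Λ β h bc (fun σ => spinAt x σ * spinAt z σ) * isingExpect G Λ β h bc (spinAt y) -
          isingExpect G Λ β h bc (fun σ => spinAt y σ * spinAt z σ) * isingExpect G Λ β h bc (spinAt x) +
          2 * (isingExpect G Λ β h bc (spinAt x) * isingExpect G Λ β h bc (spinAt y) *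
            isingExpect G Λ β h bc (spinAt z)))) h := by
  have mx := measurable_spinAt (V := V) x
  have my := measurable_spinAt (V := V) y
  have mxy : Measurable fun σ : SpinConfig V => spinAt x σ * spinAt y σ := mx.mul my
  have hxy := Literature.Probability.LatticeModels.hasDerivAt_isingExpect_field G Λ β h bc mxy
  have hx := hasDerivAt_isingExpect_spinAt_field G Λ β h bc x
  have hy := hasDerivAt_isingExpect_spinAt_field G Λ β h bc y
  refine (hxy.sub (hx.mul hy)).congr_deriv ?_
  have e1 : isingExpect G Λ β h bc (fun σ => spinAt x σ * spinAt y σ * ∑ z ∈ Λ, spinAt z σ) =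
      ∑ z ∈ Λ, isingExpect G Λ β h bc (fun σ => spinAt x σ * spinAt y σ * spinAt z σ) := by
    have : (fun σ : SpinConfig V => spinAt x σ * spinAt y σ * ∑ z ∈ Λ, spinAt z σ) =
        fun σ => ∑ z ∈ Λ, spinAt x σ * spinAt y σ * spinAt z σ := by
      funext σ; rw [Finset.mul_sum]
    rw [this, isingExpect_finset_sum' G Λ h bc β Λ (fun z σ => spinAt x σ * spinAt y σ * spinAt z σ)
      (fun z => mxy.mul (measurable_spinAt z))]
  have e2 : isingExpect G Λ β h bc (fun σ => ∑ z ∈ Λ, spinAt z σ) =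
      ∑ z ∈ Λ, isingExpect G Λ β h bc (spinAt z) :=
    isingExpect_finset_sum' G Λ h bc β Λ (fun z σ => spinAt z σ) (fun z => measurable_spinAt z)
  have e3 : ∀ z, isingExpect G Λ β h bc (fun σ => spinAt y σ * spinAt z σ) =
      isingExpect G Λ β h bc (fun σ => spinAt z σ * spinAt y σ) := by
    intro z; congr 1; funext σ; ring
  rw [e1, e2]
  simp only [Finset.mul_sum, ← Finset.sum_sub_distrib, Finset.sum_mul, ← Finset.sum_add_distrib]
  refine Finset.sum_congr rfl fun z _ => ?_
  rw [e3 z]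
  ring

/-- **GHS monotonicity of the truncated two-point function in the field**: for free or `+`
boundary condition, `β ≥ 0` and `x, y ∈ Λ`, `h ↦ ⟨σₓσ_y⟩ - ⟨σₓ⟩⟨σ_y⟩` is nonincreasing on
`[0, ∞)` (its derivative is `β ∑_z u₃(x,y,z) ≤ 0`; Lebowitz 1974, Remark (ii) after the proof:
"for `h ≥ 0`, `⟨q_A⟩` is a decreasing … function of the external fields"). [cite: Lebowitz1974, §2, Remark (ii) following the proof of the Theorem] -/
theorem antitoneOn_isingTrunc_field {Λ : Finset V} {β : ℝ} (hβ : 0 ≤ β)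
    {bc : BoundaryCondition V} (hbc : bc = .free ∨ bc = .plus) {x y : V} (hx : x ∈ Λ) (hy : y ∈ Λ) :
    AntitoneOn (fun h => isingExpect G Λ β h bc (fun σ => spinAt x σ * spinAt y σ) -
        isingExpect G Λ β h bc (spinAt x) * isingExpect G Λ β h bc (spinAt y)) (Ici 0) := by
  have hderiv := fun h => hasDerivAt_isingTrunc_field G Λ β h bc x y
  refine antitoneOn_of_deriv_nonpos (convex_Ici 0)
    (fun h _ => (hderiv h).continuousAt.continuousWithinAt)
    (fun h _ => (hderiv h).differentiableAt.differentiableWithinAt) ?_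
  intro h hh
  rw [interior_Ici] at hh
  rw [(hderiv h).deriv]
  refine mul_nonpos_iff.2 (Or.inl ⟨hβ, Finset.sum_nonpos fun z hz => ?_⟩)
  exact isingExpect_ghs G hβ (le_of_lt hh) hbc hx hy hz

/-- **GHS concavity of the finite-volume one-point function in the field** (Griffiths–Hurst–
Sherman 1970; Friedli–Velenik 2017, Remark 3.41, p. 126, and §3.9, p. 140: "it implies in
particular that the magnetization … is concave … as a function of `h ≥ 0`"): for the
nearest-neighbour Ising model in a finite volume `Λ` of a locally finite graph with free or `+`
boundary condition, `β ≥ 0` and `x ∈ Λ`, `h ↦ ⟨σₓ⟩^{bc}_{Λ;β,h}` is concave on `[0, ∞)`. [cite: FriedliVelenik2017, Remark 3.41 (p. 126) and §3.9, p. 140] [cite: Lebowitz1974, eq. (1.8)] -/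
theorem concaveOn_isingExpect_spinAt {Λ : Finset V} {β : ℝ} (hβ : 0 ≤ β)
    {bc : BoundaryCondition V} (hbc : bc = .free ∨ bc = .plus) {x : V} (hx : x ∈ Λ) :
    ConcaveOn ℝ (Ici 0) (fun h => isingExpect G Λ β h bc (spinAt x)) := by
  have hderiv := fun h => hasDerivAt_isingExpect_spinAt_field G Λ β h bc x
  refine AntitoneOn.concaveOn_of_deriv (convex_Ici 0)
    (fun h _ => (hderiv h).continuousAt.continuousWithinAt)
    (fun h _ => (hderiv h).differentiableAt.differentiableWithinAt) ?_
  rw [interior_Ici]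
  intro a ha b hb hab
  rw [(hderiv a).deriv, (hderiv b).deriv]
  refine mul_le_mul_of_nonneg_left (Finset.sum_le_sum fun y hy => ?_) hβ
  exact antitoneOn_isingTrunc_field G hβ hbc hx hy (le_of_lt (show (0 : ℝ) < a from ha))
    (le_of_lt (show (0 : ℝ) < b from hb)) hab

/-- The set form: `h ↦ ⟨σ_{{x}}⟩^{bc}_{Λ;β,h}` is concave on `[0, ∞)` (`bc ∈ {free, +}`, `β ≥ 0`,
`x ∈ Λ`). [cite: FriedliVelenik2017, Remark 3.41 (p. 126) and §3.9, p. 140] -/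
theorem concaveOn_isingCorr_singleton {Λ : Finset V} {β : ℝ} (hβ : 0 ≤ β)
    {bc : BoundaryCondition V} (hbc : bc = .free ∨ bc = .plus) {x : V} (hx : x ∈ Λ) :
    ConcaveOn ℝ (Ici 0) (fun h => isingCorr G Λ β h bc {x}) := by
  have hfun : (fun h : ℝ => isingCorr G Λ β h bc {x}) = fun h => isingExpect G Λ β h bc (spinAt x) := by
    funext h
    simp only [isingCorr]
    congr 1
    funext σ
    simp [spinProduct]
  rw [hfun]
  exact concaveOn_isingExpect_spinAt G hβ hbc hx

end Ising

end Literature.Probability.LatticeModels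

/-! ### Discharge of the named fact of `MeanFieldLowerBound` -/

namespace Literature.Probability.LatticeModels

open Percolation

/-- **Discharge of `ghs_concaveOn_isingCorr_free_singleton`** (Griffiths–Hurst–Sherman 1970;
Friedli–Velenik 2017, Remark 3.41 and §3.9, p. 140): the free-boundary-condition one-point
function `h ↦ ⟨σₓ⟩^∅_{Λ;β,h}` of a finite volume of any locally finite graph is concave on
`[0, ∞)` for `β ≥ 0`, `x ∈ Λ`. [cite: FriedliVelenik2017, Remark 3.41 (p. 126) and §3.9, p. 140] [cite: Lebowitz1974, eq. (1.8)] -/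
theorem ghs_concaveOn_isingCorr_free_singleton_holds : ghs_concaveOn_isingCorr_free_singleton := by
  intro V _ G _ Λ x hx β hβ
  exact concaveOn_isingCorr_singleton G hβ (Or.inl rfl) hx

/-- **Eq. (2.6) of Duminil-Copin–Tassion from Lemma 2.6, `ε → 0` and uniqueness at `h ≠ 0`**, the
GHS input being discharged. [cite: DuminilCopinTassionCMP2016, §2.4, eq. (2.6) (arXiv:1502.03050 numbering)] -/
theorem dct_magnetization_lower_bound_of_facts'' {d : ℕ}
    (hdi : dct_meanField_differentialInequality (d := d))
    (hbd : dct_boundaryError_tendsto_zero (d := d))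
    (huniq : freeCorr_eq_plusCorr_singleton_of_pos (d := d)) :
    dct_magnetization_lower_bound (d := d) :=
  dct_magnetization_lower_bound_of_facts' hdi hbd ghs_concaveOn_isingCorr_free_singleton_holds huniq

/-- **crit-ising.S08 from Lemma 2.6, `ε → 0` and uniqueness at `h ≠ 0`**, the GHS input being
discharged. [cite: DuminilCopinTassionCMP2016, Thm. 2.1 (third item), §2.4–2.5 (arXiv:1502.03050 numbering)] -/
theorem twoPoint_exponentialDecay_of_meanField_facts'' {d : ℕ}
    (hdi : dct_meanField_differentialInequality (d := d))
    (hbd : dct_boundaryError_tendsto_zero (d := d))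
    (huniq : freeCorr_eq_plusCorr_singleton_of_pos (d := d)) :
    twoPoint_exponentialDecay_of_lt_criticalBeta (d := d) :=
  twoPoint_exponentialDecay_of_meanField_facts' hdi hbd ghs_concaveOn_isingCorr_free_singleton_holds
    huniq

end Literature.Probability.LatticeModels
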